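import Literature.MathematicalPhysics.QuantumFieldTheory.Balaban1983to89.Node00.Record12BgRowCoClassGaugeRGuardedBRowAllTorus
import Literature.MathematicalPhysics.QuantumFieldTheory.Balaban1983to89.Node00.LargeFieldBackgroundCoPOfRecordB

/-!
# NODE 00 — ROW P11 AT node00-def-R's PRINT-DATUM BACKGROUND `UbgMSCoPOfRecordB` ON THE WHOLE TORUS FAMILY: the `(lamDatum F, UbgMSCoPOfRecordB)` instance of
# `Record12BgRowCoClassGaugeRGuardedBRowAllTorus` (`hsN` discharged by `PartCompat₁₃` at `θ.τ9.M = L^a`), any `Dat`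

Cell `pub-ymgap`, seat `pub-ymgap-k0-s1-w1` g9 (K0⁷ **stmt-QuantumFields-20541**; (E1)∕(iii-b); the allTorus instance split off from ✓`…GaugeRGuardedBRowLam` because its `hsN` supplier
`Stage13Params.hsN_of_partCompat₁₃` lives in a Stage-2 coherence-train module (`Record13SepCoPInhabitedOfThm1CCMWGaugeRAllTorus`) — this leaf is transitively red during the campaign
and green again with that module's re-key; TRAIN-K0 T1 (k0-s1-w2: `Thm/…K0AllTorusOfStepTokensGuarded` §1′) keys on it by name).  `--kind proof --supports stmt-QuantumFields-20541`
(count-neutral).  ONE theorem, 0 `def`, 0 `sorry`.  HONESTY GUARD (№338 (5)): additive instance; the (b)-instance `Thm/…K0AllTorusOfStepTokensGuarded.bgAtDatumCoP_…_allTorus` stays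
landed and true on its own text.  HONEST SCOPE: instantiation bookkeeping; nothing of [Balaban1985Variational] asserted; K0⁷ stub 1 NOT closed; N07 NOT discharged; counts unmoved; R4 =
conditional finite-𝕋⁴ rung only — NOT continuum ∕ ℝ⁴ ∕ OS; the Yang–Mills mass gap (Clay) is NOT proved.
References: [Balaban1985Variational] Thm 1 (8)–(9) p.279, Prop. 8 p.304; [Balaban1984PropagatorsII] (2.3) p.224; [Balaban1988Convergent] (2.1) p.254, (2.12)–(2.13) p.256, Thm 1 p.262;
[Balaban1987RG1] (0.1) p.251, (1.12) p.262.
-/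

noncomputable section

open MeasureTheory
open scoped Matrix.Norms.L2Operator

namespace Literature.MathematicalPhysics.QuantumFieldTheory.Balaban1983to89.Node00

open T4Continuum B14.Eq218Concrete B15DeterminingSets B15DeterminingSetsB B12RegularSpaces111 B14RegularSpaces234 B14Radii

variable {F : T4Family} {N : ℕ} [NeZero N]

/-- **★ ROW P11 AT `UbgMSCoPOfRecordB … n s 𝐖` ON THE WHOLE TORUS FAMILY** (`hsN` by `PartCompat₁₃` at `θ.τ9.M = L^a`, the guard discharged per prefix by `hAdm`, empty window at `n = 0`)
— `…GaugeRGuardedBRowAllTorus`'s ★ at `Ubg := UbgMSCoPOfRecordB …`, `bd := lamDatum F`; any `Dat`.  The `(lamDatum)`-road twin of `Thm/…K0AllTorusOfStepTokensGuarded` §1.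
[cite: Balaban1985Variational, Thm 1 (8)–(9) p.279, Prop. 8 p.304, p.304 lines 1–2; Balaban1984PropagatorsII, (2.3) p.224; Balaban1988Convergent, Thm 1 p.262, (2.1) p.254, (2.5) p.255, (2.12)–(2.13) p.256, (2.27)–(2.28) p.259, (2.34)–(2.41) p.261; Balaban1987RG1, (0.1) p.251, (1.12) p.262] -/
theorem Stage13Params.bgAtDatumCoPB_of_thm1RegSepCoP7MGB_of_thm1GaugeGB_allTorus (θ : Stage13Params F N) (hθ : θ.Admissible F N) (hRz : θ.Rz = RzOfRecord F N)
    {Adm : StepGuard F} {Dat : TopData F N} {B₃ B₃' a₀ a₁ : ℝ} (hM : 0 < θ.τ9.M)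
    (h15 : VariationalThm1RegSepCoP7MGB F N Adm (lamDatum F) Dat B₃ a₀ a₁) (h15G : VariationalThm1GaugeRegSepCoP7MGB F N θ.τ9.M Adm (lamDatum F) Dat B₃ B₃' a₀ a₁)
    (hnum : ∀ (p : B12.RunParams) (n : ℕ), n ≤ p.K → Step.InInterval θ.γ n (gOfRecord₁₃ F N θ p) → ∀ m, m ≤ n →
      0 < θ.s2.cR * epsOfRecord θ.ν (gOfRecord₁₃ F N θ p) m ∧ θ.s2.cR * epsOfRecord θ.ν (gOfRecord₁₃ F N θ p) m ≤ a₁ ∧ B₃ * (θ.s2.cR * epsOfRecord θ.ν (gOfRecord₁₃ F N θ p) m) ≤ θ.ν.εreg)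
    (ha₀ : θ.ν.εreg ≤ a₀)
    (hcomp : ∀ (p : B12.RunParams) (n : ℕ), n ≤ p.K → Step.InInterval θ.γ n (gOfRecord₁₃ F N θ p) → ∀ m, m < n →
      θ.s2.cR * epsOfRecord θ.ν (gOfRecord₁₃ F N θ p) m ≤ 2 * (θ.s2.cR * epsOfRecord θ.ν (gOfRecord₁₃ F N θ p) (m + 1)))
    (hcomp' : ∀ (p : B12.RunParams) (n : ℕ), n ≤ p.K → Step.InInterval θ.γ n (gOfRecord₁₃ F N θ p) → ∀ m, m < n →
      θ.s2.cR * epsOfRecord θ.ν (gOfRecord₁₃ F N θ p) (m + 1) ≤ 2 * (θ.s2.cR * epsOfRecord θ.ν (gOfRecord₁₃ F N θ p) m))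
    (hBα : ∀ (p : B12.RunParams) (n : ℕ), n ≤ p.K → Step.InInterval θ.γ n (gOfRecord₁₃ F N θ p) → ∀ m, 1 ≤ m → m ≤ n →
      B₃ * (θ.s2.cR * epsOfRecord θ.ν (gOfRecord₁₃ F N θ p) m) ≤ (1 - θ.s2.βc) * (lfOfRecord₁₂ F N θ.toStage12Params).alpha0 (gOfRecord₁₃ F N θ p m))
    (htI : ∀ (p : B12.RunParams) (n : ℕ), n ≤ p.K → Step.InInterval θ.γ n (gOfRecord₁₃ F N θ p) → ∀ m, 1 ≤ m → m ≤ n →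
      B₃' * (θ.s2.cR * epsOfRecord θ.ν (gOfRecord₁₃ F N θ p) m) ≤ θ.s2.cB * (lfOfRecord₁₂ F N θ.toStage12Params).alpha0 (gOfRecord₁₃ F N θ p m))
    (htMS : ∀ (p : B12.RunParams) (n : ℕ), n ≤ p.K → Step.InInterval θ.γ n (gOfRecord₁₃ F N θ p) → ∀ m, 1 ≤ m → m ≤ n →
      B₃' * (θ.s2.cR * epsOfRecord θ.ν (gOfRecord₁₃ F N θ p) m) ≤ θ.s2.B * θ.s2.C * θ.s2.Mr * (lfOfRecord₁₂ F N θ.toStage12Params).alpha0 (gOfRecord₁₃ F N θ p m))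
    (hC1 : ∀ (p : B12.RunParams) (n : ℕ), n ≤ p.K → Step.InInterval θ.γ n (gOfRecord₁₃ F N θ p) → ∀ j, 1 ≤ j → j ≤ n →
      ∃ t : ℕ, 0 < t ∧ RkOfRecord (F.P p.K).L θ.ν.r (gOfRecord₁₃ F N θ p j) = (F.P p.K).L * t)
    (hMa : ∃ a : ℕ, θ.τ9.M = F.L ^ a)
    (hAdm : ∀ (p : B12.RunParams) (n : ℕ) (s : SeqOfRecord F θ.ν θ.τ9.M (gOfRecord₁₃ F N θ p) p.K n), 1 ≤ n → n ≤ p.K →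
      Step.InInterval θ.γ n (gOfRecord₁₃ F N θ p) → PartCompat₁₃ F N θ p n → Adm θ.ν θ.τ9.M (gOfRecord₁₃ F N θ p) p.K n s) :
    ∀ (p : B12.RunParams) (n : ℕ), n ≤ p.K → Step.InInterval θ.γ n (gOfRecord₁₃ F N θ p) → PartCompat₁₃ F N θ p n →
      ∀ s : SeqOfRecord F θ.ν θ.τ9.M (gOfRecord₁₃ F N θ p) p.K n, Sect2.SeqSeparated θ.ν.M₁ s → 0 < θ.ν.M₁ → ∀ W : MSField (F.P p.K) (SU N),
      Dat p.K s.Ω (suppDomOfRecord F θ.ν p.K s.Ω) n (fun j => θ.s2.cR * epsOfRecord θ.ν (gOfRecord₁₃ F N θ p) j) W →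
      ∀ j, 1 ≤ j → j ≤ n → ∀ X : (Sect2.domSys (F.P p.K) θ.τ9.M j).Dom,
      (Sect2.domSites (F.P p.K) θ.τ9.M j X ⊆ s.Λ j →
        Sect2.ofBackgroundC (settingOfRecord₁₃ F N θ p).ι (UbgMSCoPOfRecordB F N θ.ν θ.τ9.M (gOfRecord₁₃ F N θ p) p.K n s W) ∈
          Sect2.spaceI (settingOfRecord₁₃ F N θ p) (θ.Rz p.K) θ.τ9.M j (Sect2.domSites (F.P p.K) θ.τ9.M j X)
            ((settingOfRecord₁₃ F N θ p).lf.alpha0 ((settingOfRecord₁₃ F N θ p).flow.g j)) ((settingOfRecord₁₃ F N θ p).lf.alpha1 ((settingOfRecord₁₃ F N θ p).flow.g j))) ∧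
      (Sect2.admB (F.P p.K) θ.ν θ.τ9.M (gOfRecord₁₃ F N θ p) s.Ω s.Λ j (Sect2.domSites (F.P p.K) θ.τ9.M j X) = true →
        Sect2.ofBackgroundC (settingOfRecord₁₃ F N θ p).ι (UbgMSCoPOfRecordB F N θ.ν θ.τ9.M (gOfRecord₁₃ F N θ p) p.K n s W) ∈
          Sect2.spaceMS (settingOfRecord₁₃ F N θ p) (θ.Rz p.K) θ.τ9.M j (Sect2.domSites (F.P p.K) θ.τ9.M j X) s.Ω) :=
  Stage13Params.bgAtDatumBg_of_thm1RegSepCoP7MGB_of_thm1GaugeGB_allTorus θ hθ hRz hM h15 h15G (fun p n s W => UbgMSCoPOfRecordB F N θ.ν θ.τ9.M (gOfRecord₁₃ F N θ p) p.K n s W)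
    (fun p n s W => ubgMSCoPOfRecordB_dichotomy θ.ν θ.τ9.M (gOfRecord₁₃ F N θ p) p.K n s W) hnum ha₀ hcomp hcomp' hBα htI htMS hC1 hMa hAdm

end Literature.MathematicalPhysics.QuantumFieldTheory.Balaban1983to89.Node00

end
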